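import Summits.ABC.IUTFork.Conditional.AbcOfSHvolGenuineFamily
import HarnessLib

/-!
# The fork at [IUTchIII] Corollary 3.12, L-DH level: a DATUM-LEVEL pair bound with ANY right-hand side transports to the
# `λ`-line — the split-pair / split-depth inequalities of abc-iut-s2-p5 / abc-iut-s2-p3 with a free constant `S`

Proof-only record file (D-0012; 0 definitions, no `Prop` fact) of the abc-iut cell (seat abc-iut-w5-d126, gen 5; row
«HABOVE-LOPSIDED-WITNESS», crux `ThetaPartII` = stmt-ABC-19678, (U) line, VERDICT RISK ¶7). TAKES NO SIDE on [IUTchIII]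
Cor. 3.12 or on [IUTchIV] Thm. 1.10. S. Mochizuki, *IUT IV* [Mochizuki2012], Thm. 1.10 proof Step (v) (kurims pp. 27–28),
Cor. 2.2 (ii) proof (P5) p. 46; Dupuy–Hilado [DupuyHilado2025] §3.3, §3.6 (weights `Pr(v) = n_v/[F_mod:ℚ]`), §4.7, §4.12.

abc-iut-s2-p5 (`PointDict.splitPair_le_of_hullVolumeAtDatum`, p437102-lineage) and abc-iut-s2-p3
(`PointDict.splitPairPt_le_of_hullVolumeAtDatum`, `splitDepth_le_of_hullVolumeAtDatum`, p438255) transported abc-iut-S7's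
DATUM-level pair inequality `Pr(v)·Pr(w)·(l(l+1)/12)·(μ_T(v) − μ_T(w)) ≤ δ` — there a consequence of
`Cor22.HullVolumeAtDatum P l δ` — to the POINT's own field `F_mod = ℚ(j(λ)) ⊆ F_tpd`. THIS FILE performs the SAME transport
for an ARBITRARY real right-hand side `S` and an ARBITRARY single datum `T`: the hypothesis is exactly the per-datum
conclusion shape of abc-iut-S4's `ThetaPartII.pair_le_slack_of_stub_hullRegimeAbove` (p447630) — for every support prime
`p ∈ T(I)` and all places `v, w` of `F_mod(E_F)` over `p`,
`Pr(v)·Pr(w)·(l(l+1)/12)·(P_q(v)·ln N(v)/n_v − P_q(w)·ln N(w)/n_w) ≤ S` — and the conclusions are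

* `splitPair_le_of_datumPair` — for places `v, w` of `ℚ(j(λ))` over one rational prime with `ord_v j(λ) < 0`,
  `v ∤ 2`, `v ∤ l` and (`ord_w j(λ) ≥ 0` or `w | 2` or `w | l`):
  `Pr(v)·Pr(w)·(l(l+1)/12)·((−ord_v j(λ))/(2l))·log N(v)/n_v ≤ S`;
* `splitPairPt_le_of_datumPair` — the same read on `F_tpd` when `ℚ(j(λ)) = F_tpd`;
* `splitDepth_le_of_datumPair` — at a point of one-sided split depth `ord_V j(λ) ≤ −2M` over an odd prime `p` with
  `Pr(V) = Pr(W) = 1/2`, `n_V = 1`, `log N(V) = log p`: `(l+1)·M·log p/48 ≤ S`.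

The proofs are those of abc-iut-s2-p5 / abc-iut-s2-p3 VERBATIM with the datum-level hypothesis in place of
`Cor22.HullVolumeAtDatum` (dictionary: abc-iut-S7's `mu_eq` / `residueChar_mem_supportPrimes_of_bad`, abc-iut-s2-p5's
`range_algebraMap_adjoin_jInv_eq` / `weight_finBelow_eq_of_range_eq` / `ord_mul_logNorm_div_localDegree_finBelow_eq`,
abc-iut-s2-p3's `weight_finBelow_eq_of_adjoin_eq_top`; badness via the (P5) choice `T.isP5Choice` and semistability).
USE: with `S := B(P,l) − ((l+5)/4 − d_mod)·(log-diff(λ) + (1 − 1/l)·log 𝔣^{F_tpd}_{∤2l})` (abc-iut-S4's slack) this is the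
point-level form of the registered (U)-stub's necessary condition. Nothing asserted about any point or datum; no side taken.
[cite: Mochizuki2012, IUTchIV Thm. 1.10 Step (v) p. 27–28] [cite: Mochizuki2012, IUTchIV Cor. 2.2 (ii) proof p. 46]
[cite: DupuyHilado2025, §3.3, §3.6, §4.7, §4.12] [claim: Mochizuki2012, status: disputed] for every IUT quotation.
-/

noncomputable section

namespace Summit.ABC.IUTFork

open NumberField IsDedekindDomain Literature.IUT.LogVolume Literature.IUT.HodgeTheaters
open Literature.NumberTheory.DiophantineGeometry.GenEll
open scoped Classical

namespace PointDict

variable {P : NFPoint} {l : ℕ}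

/-- **A datum-level pair bound with constant `S` forces the split-pair inequality on `ℚ(j(λ))` with the same `S`.**
`F_mod := ℚ(j(λ)) ⊆ F_tpd`; `v, w` places of `F_mod` over the rational prime `p` with `ord_v j(λ) < 0`, `v ∤ 2`, `v ∤ l` and
(`ord_w j(λ) ≥ 0` or `w | 2` or `w | l`). IF a genuine Θ-volume datum `T` at `(P, l)` satisfies, for every support prime
`p' ∈ T(I)` and all places `v', w'` of `F_mod(E_F)` over `p'`, `Pr(v')·Pr(w')·(l(l+1)/12)·(μ_T(v') − μ_T(w')) ≤ S`
(`μ_T(u) = P_q(u)·ln N(u)/n_u`), THEN `Pr(v)·Pr(w)·(l(l+1)/12)·((−ord_v j(λ))/(2l))·log N(v)/n_v ≤ S`. abc-iut-s2-p5's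
`splitPair_le_of_hullVolumeAtDatum` with the datum-level bound as hypothesis (abc-iut-S7's `mu_eq`: `μ_T` is
`(−ord j_E)/(2l)·ln N/n` on `𝕍^bad_mod` and `0` off it; `p ∈ T(I)` by `residueChar_mem_supportPrimes_of_bad`).
[cite: Mochizuki2012, IUTchIV Thm. 1.10 Step (v) p. 27–28] [cite: DupuyHilado2025, §3.3, §3.6, §4.7, §4.12]
[claim: Mochizuki2012, status: disputed] -/
theorem splitPair_le_of_datumPair (T : Cor22.ThetaVolumeDatumAt P l) {S : ℝ}
    (hpair : (letI := T.instFieldF; letI := T.instNumberFieldF; letI := T.instAlgebraF; letI := T.instFieldK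
      letI := T.instNumberFieldK; letI := T.instAlgebraK; letI := T.instFieldFbar; letI := T.instAlgebraFbar
      letI := T.instAlgebraKFbar; letI := T.instIsElliptic
      ∀ (p : ℕ) [Fact p.Prime], p ∈ T.I.supportPrimes → ∀ v w : placesOver (fieldOfModuli T.E) p,
        weight (fieldOfModuli T.E) v.1 * weight (fieldOfModuli T.E) w.1 * ((l : ℝ) * ((l : ℝ) + 1) / 12) *
          (T.I.X.qPilot v.1 * logNorm (fieldOfModuli T.E) v.1 / (localDegree (fieldOfModuli T.E) v.1 : ℝ)
            - T.I.X.qPilot w.1 * logNorm (fieldOfModuli T.E) w.1 / (localDegree (fieldOfModuli T.E) w.1 : ℝ))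
          ≤ S))
    (p : ℕ) [Fact p.Prime]
    (v w : HeightOneSpectrum (𝓞 ↥(IntermediateField.adjoin ℚ ({Cor22.jInv P.x} : Set P.F))))
    (hv : v ∈ placesOver _ p) (hw : w ∈ placesOver _ p) (hvj : ord _ v (Cor22.jMod P) < 0)
    (hv2 : ((2 : ℕ) : 𝓞 _) ∉ v.asIdeal) (hvl : ((l : ℕ) : 𝓞 _) ∉ v.asIdeal)
    (hwj : 0 ≤ ord _ w (Cor22.jMod P) ∨ ((2 : ℕ) : 𝓞 _) ∈ w.asIdeal ∨ ((l : ℕ) : 𝓞 _) ∈ w.asIdeal) :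
    weight _ v * weight _ w * ((l : ℝ) * ((l : ℝ) + 1) / 12) *
      (((-ord _ v (Cor22.jMod P) : ℤ) : ℝ) / (2 * (l : ℝ)) * logNorm _ v / (localDegree _ v : ℝ)) ≤ S := by
  letI := T.instFieldF; letI := T.instNumberFieldF; letI := T.instAlgebraF; letI := T.instFieldK
  letI := T.instNumberFieldK; letI := T.instAlgebraK; letI := T.instFieldFbar; letI := T.instAlgebraFbar
  letI := T.instAlgebraKFbar; letI := T.instIsElliptic
  -- the two copies of `F_mod` inside `F`
  set Fm : Type := ↥(IntermediateField.adjoin ℚ ({Cor22.jInv P.x} : Set P.F)) with hFm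
  letI : Algebra Fm T.F := ((algebraMap P.F T.F).comp (algebraMap Fm P.F)).toAlgebra
  have hrange : Set.range (algebraMap Fm T.F) = Set.range (algebraMap ↥(fieldOfModuli T.E) T.F) :=
    range_algebraMap_adjoin_jInv_eq T
  have hjj : algebraMap Fm T.F (Cor22.jMod P) = algebraMap ↥(fieldOfModuli T.E) T.F (ThetaData.jMod T.E) := by
    change algebraMap P.F T.F (algebraMap Fm P.F (Cor22.jMod P)) = T.E.j
    rw [T.j_eq]
    rfl
  -- places `x | v`, `y | w` of `F` and their restrictions `v', w'` to `F_mod(E_F)`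
  obtain ⟨x, hx⟩ := PlaceSection.exists_under_eq (F₀ := Fm) (K := T.F) v
  obtain ⟨y, hy⟩ := PlaceSection.exists_under_eq (F₀ := Fm) (K := T.F) w
  have hxv : finBelow Fm T.F x = v := HeightOneSpectrum.ext (by rw [← hx]; rfl)
  have hyw : finBelow Fm T.F y = w := HeightOneSpectrum.ext (by rw [← hy]; rfl)
  have hxp : x ∈ placesOver T.F p := by
    rw [mem_placesOver_iff_residueChar] at hv ⊢
    rw [← residueChar_finBelow (F := Fm), hxv, hv]
  have hyp : y ∈ placesOver T.F p := by
    rw [mem_placesOver_iff_residueChar] at hw ⊢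
    rw [← residueChar_finBelow (F := Fm), hyw, hw]
  set v' := finBelow ↥(fieldOfModuli T.E) T.F x with hv'
  set w' := finBelow ↥(fieldOfModuli T.E) T.F y with hw'
  have hv'p : v' ∈ placesOver ↥(fieldOfModuli T.E) p := finBelow_mem_placesOver _ T.F hxp
  have hw'p : w' ∈ placesOver ↥(fieldOfModuli T.E) p := finBelow_mem_placesOver _ T.F hyp
  -- `v'` is a (P5)-bad prime of `F_mod(E_F)`: `x ∤ 2l` and `E_F` is multiplicative at `x` (semistable, `ord_x j < 0`)
  have hordx : ord T.F x T.E.j < 0 := by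
    have h1 : ord Fm (finBelow Fm T.F x) (Cor22.jMod P) < 0 := by rw [hxv]; exact hvj
    rw [← Cor22.ord_algebraMap_neg_iff x (Cor22.jMod P), hjj] at h1
    exact h1
  have hmult : T.E.HasMultiplicativeReductionAt x := by
    refine (T.D.isSemistable x).resolve_left fun hgood => ?_
    have hle : x.valuation T.F T.E.j ≤ 1 := valuation_j_le_one_of_hasGoodReduction_localMinimalModel x T.E hgood
    have h0 : 0 ≤ ord T.F x T.E.j := by
      unfold ord
      rw [neg_nonneg]
      by_cases hz : x.valuation T.F T.E.j = 0
      · simp [hz]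
      · rw [← WithZero.log_one]
        exact (WithZero.log_le_log hz one_ne_zero).mpr hle
    omega
  have hx2l : ∀ q ∈ ({2, l} : Finset ℕ), ((q : ℕ) : 𝓞 T.F) ∉ x.asIdeal := by
    intro q hq hmem
    have hmem' : ((q : ℕ) : 𝓞 Fm) ∈ (finBelow Fm T.F x).asIdeal :=
      (Cor22.natCast_mem_asIdeal_finBelow_iff x q).mpr hmem
    rw [hxv] at hmem'
    simp only [Finset.mem_insert, Finset.mem_singleton] at hq
    rcases hq with rfl | rfl
    · exact hv2 hmem'
    · exact hvl hmem'
  have hv'bad : v' ∈ ThetaData.badPrimesMod T.D := by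
    have hVF : FinitePlace.mk x ∈ T.D.VFbad :=
      (T.isP5Choice (FinitePlace.mk x)).mpr (by rw [FinitePlace.maximalIdeal_mk]; exact ⟨hx2l, hmult⟩)
    have h1 := (ThetaData.mk_mem_VFbad_iff T.D x).mp hVF
    have he : HeightOneSpectrum.under (𝓞 ↥(fieldOfModuli T.E)) x = v' := HeightOneSpectrum.ext rfl
    rwa [he] at h1
  -- `w'` is NOT a (P5)-bad prime: otherwise `y ∤ 2l` and `E_F` multiplicative at `y`, so `ord_w j(λ) < 0`, `w ∤ 2`, `w ∤ l`
  have hw'not : w' ∉ ThetaData.badPrimesMod T.D := by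
    intro hbad
    have he : HeightOneSpectrum.under (𝓞 ↥(fieldOfModuli T.E)) y = w' := HeightOneSpectrum.ext rfl
    have hVF : FinitePlace.mk y ∈ T.D.VFbad := (ThetaData.mk_mem_VFbad_iff T.D y).mpr (by rw [he]; exact hbad)
    obtain ⟨hy2l, hmulty⟩ := (T.isP5Choice (FinitePlace.mk y)).mp hVF
    rw [FinitePlace.maximalIdeal_mk] at hy2l hmulty
    have hordy : ord T.F y T.E.j < 0 := ThetaData.ord_j_neg_of_hasMultiplicativeReductionAt hmulty
    rcases hwj with hge | h2 | hl2
    · have h1 : ord Fm (finBelow Fm T.F y) (Cor22.jMod P) < 0 := by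
        rw [← Cor22.ord_algebraMap_neg_iff y (Cor22.jMod P), hjj]
        exact hordy
      rw [hyw] at h1
      exact absurd h1 (not_lt.mpr hge)
    · exact hy2l 2 (by simp) ((Cor22.natCast_mem_asIdeal_finBelow_iff y 2).mp (by rw [hyw]; exact h2))
    · exact hy2l l (by simp) ((Cor22.natCast_mem_asIdeal_finBelow_iff y l).mp (by rw [hyw]; exact hl2))
  -- the datum-level pair bound at `(p, v', w')`, read through abc-iut-S7's `mu_eq` on the DATUM's `F_mod(E_F)`
  have hS7 : weight ↥(fieldOfModuli T.E) v' * weight ↥(fieldOfModuli T.E) w' * ((l : ℝ) * ((l : ℝ) + 1) / 12) *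
      (((-ord ↥(fieldOfModuli T.E) v' (ThetaData.jMod T.E) : ℤ) : ℝ) / (2 * (l : ℝ)) *
        logNorm ↥(fieldOfModuli T.E) v' / (localDegree ↥(fieldOfModuli T.E) v' : ℝ)) ≤ S := by
    have hpT : p ∈ T.I.supportPrimes := by
      have h1 := residueChar_mem_supportPrimes_of_bad T v' hv'bad
      rwa [(mem_placesOver_iff_residueChar v').mp hv'p] at h1
    have h := hpair p hpT ⟨v', hv'p⟩ ⟨w', hw'p⟩
    have hμv := mu_eq T v'
    have hμw := mu_eq T w'
    rw [if_pos hv'bad] at hμv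
    rw [if_neg hw'not] at hμw
    have e : weight ↥(fieldOfModuli T.E) v' * weight ↥(fieldOfModuli T.E) w' * ((l : ℝ) * ((l : ℝ) + 1) / 12) *
        (T.I.X.qPilot v' * logNorm ↥(fieldOfModuli T.E) v' / (localDegree ↥(fieldOfModuli T.E) v' : ℝ)
          - T.I.X.qPilot w' * logNorm ↥(fieldOfModuli T.E) w' / (localDegree ↥(fieldOfModuli T.E) w' : ℝ)) ≤ S := h
    rw [hμv, hμw, sub_zero] at e
    exact e
  -- transport the weights and the normalised local height to the POINT's `F_mod = ℚ(j(λ))`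
  have hwv : weight ↥(fieldOfModuli T.E) v' = weight Fm v := by
    rw [← hxv]; exact (weight_finBelow_eq_of_range_eq hrange x hxp).symm
  have hww : weight ↥(fieldOfModuli T.E) w' = weight Fm w := by
    rw [← hyw]; exact (weight_finBelow_eq_of_range_eq hrange y hyp).symm
  have hμ : ((-ord ↥(fieldOfModuli T.E) v' (ThetaData.jMod T.E) : ℤ) : ℝ) / (2 * (l : ℝ)) *
        logNorm ↥(fieldOfModuli T.E) v' / (localDegree ↥(fieldOfModuli T.E) v' : ℝ) =
      ((-ord Fm v (Cor22.jMod P) : ℤ) : ℝ) / (2 * (l : ℝ)) * logNorm Fm v / (localDegree Fm v : ℝ) := by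
    have key := ord_mul_logNorm_div_localDegree_finBelow_eq (A := Fm) (B := ↥(fieldOfModuli T.E)) hjj x
    rw [hxv] at key
    have e : ∀ a L n : ℝ, -a / (2 * (l : ℝ)) * L / n = -(1 / (2 * (l : ℝ))) * (a * L / n) := fun _ _ _ => by ring
    push_cast
    rw [e, e, key]
  rw [hwv, hww, hμ] at hS7
  exact hS7

/-- **The same read on the presenting field when `ℚ(j(λ)) = F_tpd`.** For `P = (F_tpd, λ)` with `ℚ(j(λ)) = F_tpd`,
places `V, W` of `F_tpd` over one rational prime `p` with `ord_V j(λ) < 0`, `V ∤ 2`, `V ∤ l` and `0 ≤ ord_W j(λ)`: a datum-level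
pair bound with constant `S` at a genuine datum `T` of `(P, l)` gives
`Pr(V)·Pr(W)·(l(l+1)/12)·((−ord_V j(λ))/(2l))·log N(V)/n_V ≤ S` (abc-iut-s2-p3's `splitPairPt_le_of_hullVolumeAtDatum` with
`S` for `δ`: `finBelow` injective, weights and normalised local heights invariant). Nothing asserted about any point.
[cite: Mochizuki2012, IUTchIV Thm. 1.10 Step (v) p. 27–28] [cite: DupuyHilado2025, §3.3, §3.6, §4.7, §4.12]
[claim: Mochizuki2012, status: disputed] -/
theorem splitPairPt_le_of_datumPair (T : Cor22.ThetaVolumeDatumAt P l) {S : ℝ}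
    (hpair : (letI := T.instFieldF; letI := T.instNumberFieldF; letI := T.instAlgebraF; letI := T.instFieldK
      letI := T.instNumberFieldK; letI := T.instAlgebraK; letI := T.instFieldFbar; letI := T.instAlgebraFbar
      letI := T.instAlgebraKFbar; letI := T.instIsElliptic
      ∀ (p : ℕ) [Fact p.Prime], p ∈ T.I.supportPrimes → ∀ v w : placesOver (fieldOfModuli T.E) p,
        weight (fieldOfModuli T.E) v.1 * weight (fieldOfModuli T.E) w.1 * ((l : ℝ) * ((l : ℝ) + 1) / 12) *
          (T.I.X.qPilot v.1 * logNorm (fieldOfModuli T.E) v.1 / (localDegree (fieldOfModuli T.E) v.1 : ℝ)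
            - T.I.X.qPilot w.1 * logNorm (fieldOfModuli T.E) w.1 / (localDegree (fieldOfModuli T.E) w.1 : ℝ))
          ≤ S))
    (htop : IntermediateField.adjoin ℚ ({Cor22.jInv P.x} : Set P.F) = ⊤)
    (p : ℕ) [Fact p.Prime] (V W : HeightOneSpectrum (𝓞 P.F)) (hV : V ∈ placesOver P.F p) (hW : W ∈ placesOver P.F p)
    (hVj : ord P.F V (Cor22.jInv P.x) < 0) (hV2 : ((2 : ℕ) : 𝓞 P.F) ∉ V.asIdeal) (hVl : ((l : ℕ) : 𝓞 P.F) ∉ V.asIdeal)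
    (hWj : 0 ≤ ord P.F W (Cor22.jInv P.x)) :
    weight P.F V * weight P.F W * ((l : ℝ) * ((l : ℝ) + 1) / 12) *
      (((-ord P.F V (Cor22.jInv P.x) : ℤ) : ℝ) / (2 * (l : ℝ)) * logNorm P.F V / (localDegree P.F V : ℝ)) ≤ S := by
  set Fm : Type := ↥(IntermediateField.adjoin ℚ ({Cor22.jInv P.x} : Set P.F)) with hFm
  set v := finBelow Fm P.F V with hv_def
  set w := finBelow Fm P.F W with hw_def
  have hv : v ∈ placesOver Fm p := finBelow_mem_placesOver Fm P.F hV
  have hw : w ∈ placesOver Fm p := finBelow_mem_placesOver Fm P.F hW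
  have hj : algebraMap Fm P.F (Cor22.jMod P) = Cor22.jInv P.x := rfl
  have hvj : ord Fm v (Cor22.jMod P) < 0 := (Cor22.ord_algebraMap_neg_iff V (Cor22.jMod P)).mp (by rw [hj]; exact hVj)
  have hv2 : ((2 : ℕ) : 𝓞 Fm) ∉ v.asIdeal := fun h2 => hV2 ((Cor22.natCast_mem_asIdeal_finBelow_iff V 2).mp h2)
  have hvl : ((l : ℕ) : 𝓞 Fm) ∉ v.asIdeal := fun h2 => hVl ((Cor22.natCast_mem_asIdeal_finBelow_iff V l).mp h2)
  have hwj : 0 ≤ ord Fm w (Cor22.jMod P) ∨ ((2 : ℕ) : 𝓞 Fm) ∈ w.asIdeal ∨ ((l : ℕ) : 𝓞 Fm) ∈ w.asIdeal := by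
    refine Or.inl (not_lt.mp fun hlt => ?_)
    have := (Cor22.ord_algebraMap_neg_iff W (Cor22.jMod P)).mpr hlt
    rw [hj] at this
    exact absurd this (not_lt.mpr hWj)
  have key := splitPair_le_of_datumPair T hpair p v w hv hw hvj hv2 hvl hwj
  rw [weight_finBelow_eq_of_adjoin_eq_top htop V hV, weight_finBelow_eq_of_adjoin_eq_top htop W hW] at key
  have hh : (ord P.F V (Cor22.jInv P.x) : ℝ) * logNorm P.F V / (localDegree P.F V : ℝ) =
      (ord Fm v (Cor22.jMod P) : ℝ) * logNorm Fm v / (localDegree Fm v : ℝ) :=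
    ord_mul_logNorm_div_localDegree_algebraMap V (Cor22.jMod P)
  have hterm : ((-ord P.F V (Cor22.jInv P.x) : ℤ) : ℝ) / (2 * (l : ℝ)) * logNorm P.F V / (localDegree P.F V : ℝ) =
      ((-ord Fm v (Cor22.jMod P) : ℤ) : ℝ) / (2 * (l : ℝ)) * logNorm Fm v / (localDegree Fm v : ℝ) := by
    push_cast
    calc -(ord P.F V (Cor22.jInv P.x) : ℝ) / (2 * (l : ℝ)) * logNorm P.F V / (localDegree P.F V : ℝ)
        = -(1 / (2 * (l : ℝ))) * ((ord P.F V (Cor22.jInv P.x) : ℝ) * logNorm P.F V / (localDegree P.F V : ℝ)) := by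
          ring
      _ = -(1 / (2 * (l : ℝ))) * ((ord Fm v (Cor22.jMod P) : ℝ) * logNorm Fm v / (localDegree Fm v : ℝ)) := by rw [hh]
      _ = -(ord Fm v (Cor22.jMod P) : ℝ) / (2 * (l : ℝ)) * logNorm Fm v / (localDegree Fm v : ℝ) := by ring
  rw [hterm]
  exact key

/-- **At a point of one-sided split depth `≥ 2M` a datum-level pair bound with constant `S` forces `(l+1)·M·log p/48 ≤ S`.**
For `P = (F, λ)` with `ℚ(j(λ)) = F`, places `V, W` of `F` over the odd prime `p` with `Pr(V) = Pr(W) = 1/2`, `n_V = 1`,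
`log N(V) = log p`, `ord_V j(λ) ≤ −2M` (`M ≥ 1`), `0 ≤ ord_W j(λ)`, `V ∤ 2`, `V ∤ l` (abc-iut-s2-p3's split-depth shape), and a
genuine datum `T` of `(P, l)` satisfying the datum-level pair bound with constant `S`: `(l+1)·M·log p/48 ≤ S`
(abc-iut-s2-p3's `splitDepth_le_of_hullVolumeAtDatum` with `S` for `δ`). Nothing asserted about any point.
[cite: Mochizuki2012, IUTchIV Thm. 1.10 Step (v) p. 27–28] [cite: DupuyHilado2025, §3.3, §3.6, §4.7]
[claim: Mochizuki2012, status: disputed] -/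
theorem splitDepth_le_of_datumPair {F : Type} [Field F] [NumberField F] {x : F} {S : ℝ}
    (T : Cor22.ThetaVolumeDatumAt (NFPoint.mk F x) l)
    (hpair : (letI := T.instFieldF; letI := T.instNumberFieldF; letI := T.instAlgebraF; letI := T.instFieldK
      letI := T.instNumberFieldK; letI := T.instAlgebraK; letI := T.instFieldFbar; letI := T.instAlgebraFbar
      letI := T.instAlgebraKFbar; letI := T.instIsElliptic
      ∀ (p : ℕ) [Fact p.Prime], p ∈ T.I.supportPrimes → ∀ v w : placesOver (fieldOfModuli T.E) p,
        weight (fieldOfModuli T.E) v.1 * weight (fieldOfModuli T.E) w.1 * ((l : ℝ) * ((l : ℝ) + 1) / 12) *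
          (T.I.X.qPilot v.1 * logNorm (fieldOfModuli T.E) v.1 / (localDegree (fieldOfModuli T.E) v.1 : ℝ)
            - T.I.X.qPilot w.1 * logNorm (fieldOfModuli T.E) w.1 / (localDegree (fieldOfModuli T.E) w.1 : ℝ))
          ≤ S))
    (hl : 0 < l) (htop : IntermediateField.adjoin ℚ ({Cor22.jInv x} : Set F) = ⊤) {p : ℕ} [Fact p.Prime]
    {V W : HeightOneSpectrum (𝓞 F)} (hV : V ∈ placesOver F p) (hW : W ∈ placesOver F p) {M : ℕ} (hM : 1 ≤ M)
    (hVj : ord F V (Cor22.jInv x) ≤ -(2 * M : ℤ)) (hWj : 0 ≤ ord F W (Cor22.jInv x))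
    (hV2 : ((2 : ℕ) : 𝓞 F) ∉ V.asIdeal) (hVl : ((l : ℕ) : 𝓞 F) ∉ V.asIdeal)
    (hwV : weight F V = 1 / 2) (hwW : weight F W = 1 / 2) (hnV : localDegree F V = 1) (hNV : logNorm F V = Real.log p) :
    ((l : ℝ) + 1) * M * Real.log p / 48 ≤ S := by
  have key := splitPairPt_le_of_datumPair (P := NFPoint.mk F x) T hpair htop p V W hV hW
    (by show ord F V (Cor22.jInv x) < 0; omega) hV2 hVl hWj
  change weight F V * weight F W * ((l : ℝ) * ((l : ℝ) + 1) / 12) *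
      (((-ord F V (Cor22.jInv x) : ℤ) : ℝ) / (2 * (l : ℝ)) * logNorm F V / (localDegree F V : ℝ)) ≤ S at key
  rw [hwV, hwW, hnV, hNV] at key
  have hl0 : (0 : ℝ) < l := by exact_mod_cast hl
  have hlogp : 0 < Real.log p := Real.log_pos (by exact_mod_cast (Fact.out : p.Prime).one_lt)
  have hM' : (2 * M : ℝ) ≤ -(ord F V (Cor22.jInv x) : ℝ) := by
    have : (2 * M : ℤ) ≤ -ord F V (Cor22.jInv x) := by omega
    exact_mod_cast this
  have e1 : ((l : ℝ) + 1) * M * Real.log p / 48 =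
      1 / 2 * (1 / 2) * ((l : ℝ) * ((l : ℝ) + 1) / 12) * ((2 * M : ℝ) / (2 * (l : ℝ)) * Real.log p / ((1 : ℕ) : ℝ)) := by
    push_cast
    field_simp
    ring
  rw [e1]
  refine le_trans ?_ key
  have hc : 0 ≤ 1 / 2 * (1 / 2) * ((l : ℝ) * ((l : ℝ) + 1) / 12) := by positivity
  refine mul_le_mul_of_nonneg_left ?_ hc
  push_cast
  rw [div_one, div_one]
  exact mul_le_mul_of_nonneg_right (div_le_div_of_nonneg_right hM' (by positivity)) hlogp.le

end PointDict

end Summit.ABC.IUTFork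

end
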